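import Mathlib.RepresentationTheory.Homological.GroupCohomology.LowDegree
import HarnessLib

/-!
# Non-abelian `H¹(Γ, A)` of a `Γ`-group as a pointed set, and the kernel
# `𝔇 = ker (H¹(Γ, T) → H¹(Γ, G))` for an abelian `Γ`-group `T` mapping to `G`

Topic `NumberTheory/GaloisCohomology`; namespace `Literature.NumberTheory.GaloisCohomology`.
DEFINITIONS WITH BODIES + proved lemmas; no named fact, no `sorry`, no instance, no notation.

Let `Γ` be a group acting on a group `A` by group automorphisms (Mathlib `MulDistribMulAction Γ A`;
in the applications `Γ = Gal(K/F)` and `A = G(K)` for an algebraic group `G`).  Following Serre,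
*Galois Cohomology* I §5.1 and Berhuy, *An Introduction to Galois Cohomology* §II.3:

* `IsNonAbelianCocycle₁ a` — `a : Γ → A` is a 1-COCYCLE: `a (σ τ) = a σ · σ(a τ)` [Berhuy2010, Def. II.3.7];
  the split cocycles `splitCocycle b = (σ ↦ b σ(b)⁻¹)` [Lemma II.3.9];
* `Cohomologous a a'` — `a' σ = b · a σ · σ(b)⁻¹` for some `b ∈ A` [Def. II.3.10]; an equivalence relation
  on cocycles (`cocycleSetoid`);
* `NonAbelianH1 Γ A := Z¹(Γ, A)/∼`, a POINTED SET with base point `NonAbelianH1.base` = the class of the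
  trivial cocycle [Def. II.3.12–II.3.13]; `mk_eq_base_iff`: `[a] = base ↔ ∃ b, a = splitCocycle b`;
* for an ABELIAN `Γ`-group `T` (Mathlib: `CommGroup T`, `MulDistribMulAction Γ T`, cohomology
  `groupCohomology.H1 (Rep.ofMulDistribMulAction Γ T)`) and a `Γ`-equivariant hom `ι : T →* G` into a
  `Γ`-group `G`: the induced map of pointed sets `H1toNonAbelian ι hι : H¹(Γ, T) → H¹(Γ, G)`
  [Prop. II.3.19] and its KERNEL [Def. II.4.1]
  `kerH1 ι hι = 𝔇 := ker (H¹(Γ, T) → H¹(Γ, G)) ⊆ H¹(Γ, T)`, with the concrete description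
  `H1π a ∈ 𝔇 ↔ ∃ g ∈ G, ∀ σ, ι (a σ) = g σ(g)⁻¹` (`H1π_mem_kerH1_iff`).  This is the object
  `𝔇(I/F) = Ker{H¹(F, G_γ) → H¹(F, G)}` of Rogawski, *Automorphic representations of unitary groups in
  three variables* §3.1 (p. 19) for a maximal torus / abelian centraliser `I = T`, which parametrises the
  conjugacy classes inside a stable conjugacy class (see `Literature/NumberTheory/Rogawski1990/StableConjugacyU3`);
* the two sentences of [Rogawski1990, §3.1] linking stable conjugacy and cocycles, for `γ ∈ A^Γ` and `g ∈ A`: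
  `g⁻¹ γ g ∈ A^Γ ↔ (σ ↦ g σ(g)⁻¹)` takes values in the centraliser of `γ`
  (`smul_conj_eq_self_iff_splitCocycle_mem_centralizer`).

## Conventions (recorded)

Cocycle condition and coboundaries follow Serre/Berhuy (`a_{στ} = a_σ σ(a_τ)`, `a ∼ b a σ(b)⁻¹`).  For
ABELIAN coefficients this is Mathlib's `groupCohomology.IsMulCocycle₁` (`isNonAbelianCocycle₁_iff_isMulCocycle₁`)
and cohomologous = «differ by a multiplicative coboundary» (`cohomologous_iff`), so `H1toNonAbelian` is
well defined on Mathlib's `H1`.  Rogawski prints the representative `{τ(g)g⁻¹}` for the class attached to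
`δ = g⁻¹γg`; with Serre's condition the cocycle attached to `δ` is its pointwise inverse `σ ↦ g σ(g)⁻¹`
(`splitCocycle g`), which is what is typed here.  Universe: the kernel section lives in `Type` (=
Mathlib's `Rep.ofMulDistribMulAction`, `groupCohomology` require one universe; `Type 0` as in the tree's
`Frobenioids/KummerClass`).  NOT here: continuity for profinite `Γ` (take `Γ` finite/discrete), the long
exact sequence, twisting, `H¹` of a torus over a local field being finite.

## References
* [Berhuy2010] G. Berhuy, *An Introduction to Galois Cohomology and its Applications*, LMS LN 377 (2010),
  §II.3 Def. II.3.7, Lemma II.3.9, Def. II.3.10, II.3.12, II.3.13; §II.4 Def. II.4.1, Cor. II.4.5.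
* [SerreGaloisCohomology1997] J.-P. Serre, *Galois Cohomology* (1997), Ch. I §5.1–5.4.
* [Rogawski1990] J. Rogawski, Ann. of Math. Stud. 123 (1990), §3.1 p. 19.
-/

namespace Literature.NumberTheory.GaloisCohomology

open groupCohomology

section NonAbelian

variable {Γ : Type*} [Group Γ] {A : Type*} [Group A] [MulDistribMulAction Γ A]

/-- A map `a : Γ → A` into a `Γ`-group is a **1-cocycle** if `a (σ * τ) = a σ * σ • a τ`.
[cite: Berhuy2010, §II.3 Def. II.3.7] -/
def IsNonAbelianCocycle₁ (a : Γ → A) : Prop :=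
  ∀ σ τ : Γ, a (σ * τ) = a σ * σ • a τ

/-- The trivial map `σ ↦ 1` is a 1-cocycle. [cite: Berhuy2010, §II.3 Def. II.3.7] -/
theorem isNonAbelianCocycle₁_one : IsNonAbelianCocycle₁ (1 : Γ → A) := fun σ τ => by
  simp only [Pi.one_apply, smul_one, mul_one]

/-- A 1-cocycle vanishes at `1`. [cite: Berhuy2010, §II.3 Def. II.3.7] -/
theorem IsNonAbelianCocycle₁.map_one {a : Γ → A} (ha : IsNonAbelianCocycle₁ a) : a 1 = 1 := by
  have h := ha 1 1
  rw [mul_one, one_smul] at h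
  exact mul_eq_left.mp h.symm

/-- The **split cocycle** of `b ∈ A`: `σ ↦ b * (σ • b)⁻¹` (the cocycles cohomologous to the trivial one).
[cite: Berhuy2010, §II.3 Lemma II.3.9] -/
def splitCocycle (b : A) : Γ → A := fun σ => b * (σ • b)⁻¹

/-- Unfolding `splitCocycle`. [cite: Berhuy2010, §II.3 Lemma II.3.9] -/
theorem splitCocycle_apply (b : A) (σ : Γ) : splitCocycle b σ = b * (σ • b)⁻¹ := rfl

/-- Twisting a cocycle by `b`: `σ ↦ b * a σ * (σ • b)⁻¹` is a cocycle. [cite: Berhuy2010, §II.3 Lemma II.3.9] -/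
theorem IsNonAbelianCocycle₁.twist {a : Γ → A} (ha : IsNonAbelianCocycle₁ a) (b : A) :
    IsNonAbelianCocycle₁ fun σ => b * a σ * (σ • b)⁻¹ := by
  intro σ τ
  simp only [ha σ τ, mul_smul, smul_mul', smul_inv']
  group

/-- Split cocycles are cocycles. [cite: Berhuy2010, §II.3 Lemma II.3.9] -/
theorem isNonAbelianCocycle₁_splitCocycle (b : A) : IsNonAbelianCocycle₁ (splitCocycle (Γ := Γ) b) := by
  have h := (isNonAbelianCocycle₁_one (Γ := Γ) (A := A)).twist b
  simp only [Pi.one_apply, mul_one] at h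
  exact h

/-- Two maps `a a' : Γ → A` are **cohomologous** if `a' σ = b * a σ * (σ • b)⁻¹` for some `b ∈ A`.
[cite: Berhuy2010, §II.3 Def. II.3.10] -/
def Cohomologous (a a' : Γ → A) : Prop :=
  ∃ b : A, ∀ σ : Γ, a' σ = b * a σ * (σ • b)⁻¹

/-- `∼` is reflexive. [cite: Berhuy2010, §II.3 Def. II.3.12] -/
theorem Cohomologous.refl (a : Γ → A) : Cohomologous a a :=
  ⟨1, fun σ => by rw [smul_one, inv_one, one_mul, mul_one]⟩

/-- `∼` is symmetric. [cite: Berhuy2010, §II.3 Def. II.3.12] -/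
theorem Cohomologous.symm {a a' : Γ → A} (h : Cohomologous a a') : Cohomologous a' a := by
  obtain ⟨b, hb⟩ := h
  refine ⟨b⁻¹, fun σ => ?_⟩
  rw [hb σ, smul_inv', inv_inv]
  group

/-- `∼` is transitive. [cite: Berhuy2010, §II.3 Def. II.3.12] -/
theorem Cohomologous.trans {a a' a'' : Γ → A} (h : Cohomologous a a') (h' : Cohomologous a' a'') :
    Cohomologous a a'' := by
  obtain ⟨b, hb⟩ := h
  obtain ⟨c, hc⟩ := h'
  refine ⟨c * b, fun σ => ?_⟩
  rw [hc σ, hb σ, smul_mul', mul_inv_rev]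
  group

/-- A map is cohomologous to the trivial cocycle iff it is a split cocycle. [cite: Berhuy2010, §II.3 Def. II.3.10] -/
theorem cohomologous_one_iff (a : Γ → A) : Cohomologous 1 a ↔ ∃ b : A, a = splitCocycle b := by
  simp only [Cohomologous, Pi.one_apply, mul_one, splitCocycle, funext_iff]

variable (Γ A) in
/-- The setoid of cohomologous 1-cocycles `Z¹(Γ, A)/∼`. [cite: Berhuy2010, §II.3 Def. II.3.12] -/
def cocycleSetoid : Setoid {a : Γ → A // IsNonAbelianCocycle₁ a} where
  r a a' := Cohomologous a.1 a'.1
  iseqv := ⟨fun a => Cohomologous.refl a.1, fun h => h.symm, fun h h' => h.trans h'⟩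

variable (Γ A) in
/-- **The first non-abelian cohomology set `H¹(Γ, A) = Z¹(Γ, A)/∼`.** [cite: Berhuy2010, §II.3 Def. II.3.12] -/
def NonAbelianH1 : Type _ := Quotient (cocycleSetoid Γ A)

namespace NonAbelianH1

/-- The class `[a] ∈ H¹(Γ, A)` of a cocycle `a`. [cite: Berhuy2010, §II.3 Def. II.3.12] -/
def mk (a : Γ → A) (ha : IsNonAbelianCocycle₁ a) : NonAbelianH1 Γ A :=
  Quotient.mk (cocycleSetoid Γ A) ⟨a, ha⟩

/-- Every class is the class of a cocycle. [cite: Berhuy2010, §II.3 Def. II.3.12] -/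
theorem mk_surjective (x : NonAbelianH1 Γ A) : ∃ (a : Γ → A) (ha : IsNonAbelianCocycle₁ a), mk a ha = x := by
  induction x using Quotient.inductionOn with
  | h a => exact ⟨a.1, a.2, rfl⟩

/-- `[a] = [a'] ↔ a ∼ a'`. [cite: Berhuy2010, §II.3 Def. II.3.12] -/
theorem mk_eq_mk_iff {a a' : Γ → A} (ha : IsNonAbelianCocycle₁ a) (ha' : IsNonAbelianCocycle₁ a') :
    mk a ha = mk a' ha' ↔ Cohomologous a a' :=
  Quotient.eq (r := cocycleSetoid Γ A)

variable (Γ A) in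
/-- The **base point** of `H¹(Γ, A)`: the class of the trivial cocycle. [cite: Berhuy2010, §II.3 Def. II.3.13] -/
def base : NonAbelianH1 Γ A := mk 1 isNonAbelianCocycle₁_one

/-- `[a]` is the base point iff `a` is split: `a σ = b * (σ • b)⁻¹`. [cite: Berhuy2010, §II.3 Def. II.3.10, II.3.13] -/
theorem mk_eq_base_iff {a : Γ → A} (ha : IsNonAbelianCocycle₁ a) :
    mk a ha = base Γ A ↔ ∃ b : A, a = splitCocycle b := by
  rw [base, eq_comm, mk_eq_mk_iff, cohomologous_one_iff]

/-- The class of a split cocycle is the base point. [cite: Berhuy2010, §II.3 Def. II.3.13] -/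
theorem mk_splitCocycle (b : A) :
    mk (splitCocycle b) (isNonAbelianCocycle₁_splitCocycle b) = base Γ A :=
  (mk_eq_base_iff _).mpr ⟨b, rfl⟩

end NonAbelianH1

/-- **Stable conjugacy and cocycles** [Rogawski1990, §3.1]: for a `Γ`-fixed `γ` and any `g`, the conjugate
`g⁻¹ γ g` is `Γ`-fixed iff the split cocycle `σ ↦ g (σ • g)⁻¹` takes its values in the centraliser of `γ`
(«`τ(g)g⁻¹ ∈ I(F̄)` for all `τ ∈ Γ` … Conversely, if … then `g⁻¹γg` belongs to `G`»).
[cite: Rogawski1990, §3.1 p. 19] -/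
theorem smul_conj_eq_self_iff_splitCocycle_mem_centralizer {γ : A} (hγ : ∀ σ : Γ, σ • γ = γ) (g : A) :
    (∀ σ : Γ, σ • (g⁻¹ * γ * g) = g⁻¹ * γ * g) ↔
      ∀ σ : Γ, splitCocycle g σ ∈ Subgroup.centralizer ({γ} : Set A) := by
  refine forall_congr' fun σ => ?_
  have e1 : σ • (g⁻¹ * γ * g) = (σ • g)⁻¹ * γ * (σ • g) := by rw [smul_mul', smul_mul', smul_inv', hγ]
  rw [e1, Subgroup.mem_centralizer_singleton_iff, splitCocycle_apply]
  -- `(σg)⁻¹ γ (σg) = g⁻¹ γ g ↔ g (σg)⁻¹ γ = γ g (σg)⁻¹`: both say `u := g (σg)⁻¹` commutes with `γ`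
  constructor
  · intro h
    calc g * (σ • g)⁻¹ * γ = g * ((σ • g)⁻¹ * γ * (σ • g)) * (σ • g)⁻¹ := by group
      _ = g * (g⁻¹ * γ * g) * (σ • g)⁻¹ := by rw [h]
      _ = γ * (g * (σ • g)⁻¹) := by group
  · intro h
    calc (σ • g)⁻¹ * γ * (σ • g) = g⁻¹ * (g * (σ • g)⁻¹ * γ) * (σ • g) := by group
      _ = g⁻¹ * (γ * (g * (σ • g)⁻¹)) * (σ • g) := by rw [h]
      _ = g⁻¹ * γ * g := by group

end NonAbelian

/-! ## The kernel `𝔇 = ker (H¹(Γ, T) → H¹(Γ, G))` for abelian `T` over Mathlib's `groupCohomology.H1` -/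

section Kernel

variable {Γ : Type} [Group Γ] {G : Type} [Group G] [MulDistribMulAction Γ G]
  {T : Type} [CommGroup T] [MulDistribMulAction Γ T]

/-- For ABELIAN coefficients the non-abelian cocycle condition is Mathlib's `IsMulCocycle₁`. [cite: Berhuy2010, §II.3 Def. II.3.7] -/
theorem isNonAbelianCocycle₁_iff_isMulCocycle₁ (a : Γ → T) : IsNonAbelianCocycle₁ a ↔ IsMulCocycle₁ a :=
  forall₂_congr fun σ τ => by rw [mul_comm (a σ)]

/-- For abelian coefficients, `a ∼ a'` iff `a'` is `a` times a multiplicative coboundary: `a' σ = a σ * (t / σ • t)`.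
[cite: Berhuy2010, §II.3 Def. II.3.10] -/
theorem cohomologous_iff (a a' : Γ → T) : Cohomologous a a' ↔ ∃ t : T, ∀ σ, a' σ = a σ * (t / σ • t) :=
  exists_congr fun t => forall_congr' fun σ => by rw [div_eq_mul_inv, mul_assoc, mul_left_comm t, ← mul_assoc]

/-- A Mathlib 1-cocycle `a ∈ Z¹(Γ, T)` of `Rep.ofMulDistribMulAction Γ T`, read multiplicatively `Γ → T`. [folklore] -/
def toMulFun (a : cocycles₁ (Rep.ofMulDistribMulAction Γ T)) : Γ → T := fun σ => Additive.toMul (a σ)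

/-- Unfolding `toMulFun`. [cite: Berhuy2010, §II.3 Def. II.3.16, Rem. II.3.17 (3)] -/
theorem toMulFun_apply (a : cocycles₁ (Rep.ofMulDistribMulAction Γ T)) (σ : Γ) :
    toMulFun a σ = Additive.toMul (a σ) := rfl

/-- A Mathlib 1-cocycle, read multiplicatively, is a multiplicative 1-cocycle (the additive `d₁`-kernel condition is the
cocycle identity). [cite: Berhuy2010, §II.3 Def. II.3.16, Rem. II.3.17 (3)] -/
theorem isMulCocycle₁_toMulFun (a : cocycles₁ (Rep.ofMulDistribMulAction Γ T)) : IsMulCocycle₁ (toMulFun a) :=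
  isMulCocycle₁_of_mem_cocycles₁ (M := T) _ a.2

/-- Two Mathlib cocycles with the same class in `H¹(Γ, T) = Z¹/B¹` are cohomologous in the sense of Def. II.3.10 («Definition
II.3.12 is consistent with Definition II.3.16»). [cite: Berhuy2010, §II.3 Def. II.3.16, Rem. II.3.17 (3)] -/
theorem cohomologous_of_H1π_eq {a a' : cocycles₁ (Rep.ofMulDistribMulAction Γ T)}
    (h : H1π _ a = H1π _ a') : Cohomologous (toMulFun a) (toMulFun a') := by
  rw [H1π_eq_iff] at h
  obtain ⟨x, hx⟩ := h
  rw [cohomologous_iff]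
  set t : T := Additive.toMul (α := T) x with ht
  refine ⟨t, fun σ => ?_⟩
  have hσ := congr_fun hx σ
  rw [d₀₁_hom_apply, Pi.sub_apply] at hσ
  -- `σ • x - x = a σ - a' σ` in `Additive T`; solve for `a' σ` and read it multiplicatively
  have h2 : a' σ = a σ + (x - (Rep.ofMulDistribMulAction Γ T).ρ σ x) := by
    calc a' σ = a σ - (a σ - a' σ) := by abel
      _ = a σ - ((Rep.ofMulDistribMulAction Γ T).ρ σ x - x) := by rw [hσ]
      _ = a σ + (x - (Rep.ofMulDistribMulAction Γ T).ρ σ x) := by abel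
  rw [toMulFun_apply, toMulFun_apply, h2]
  rfl

/-- `H1π : Z¹(Γ, T) → H¹(Γ, T) = Z¹/B¹` is surjective. [cite: Berhuy2010, §II.3 Def. II.3.16] -/
theorem H1π_surjective : Function.Surjective (H1π (Rep.ofMulDistribMulAction Γ T)) :=
  (ModuleCat.epi_iff_surjective _).mp inferInstance

variable (ι : T →* G) (hι : ∀ (σ : Γ) (t : T), ι (σ • t) = σ • ι t)

section
include hι

/-- A `Γ`-equivariant hom `ι : T →* G` pushes abelian cocycles to non-abelian cocycles. [cite: Berhuy2010, §II.3 Prop. II.3.19] -/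
theorem isNonAbelianCocycle₁_comp {a : Γ → T} (ha : IsMulCocycle₁ a) : IsNonAbelianCocycle₁ (⇑ι ∘ a) := by
  intro σ τ
  simp only [Function.comp_apply]
  rw [ha σ τ, mul_comm, map_mul, hι]

/-- … and cohomologous cocycles to cohomologous cocycles. [cite: Berhuy2010, §II.3 Prop. II.3.19] -/
theorem cohomologous_comp {a a' : Γ → T} (h : Cohomologous a a') : Cohomologous (⇑ι ∘ a) (⇑ι ∘ a') := by
  obtain ⟨t, ht⟩ := (cohomologous_iff a a').mp h
  refine ⟨ι t, fun σ => ?_⟩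
  simp only [Function.comp_apply]
  rw [ht σ, map_mul, map_div, hι, div_eq_mul_inv, ← mul_assoc, ← map_mul, mul_comm (a σ) t, map_mul]

end

/-- The map `Z¹(Γ, T) → H¹(Γ, G)` induced by `ι` on Mathlib's 1-cocycles. [cite: Berhuy2010, §II.3 Prop. II.3.19] -/
def cocyclesToNonAbelianH1 (a : cocycles₁ (Rep.ofMulDistribMulAction Γ T)) : NonAbelianH1 Γ G :=
  NonAbelianH1.mk (⇑ι ∘ toMulFun a) (isNonAbelianCocycle₁_comp ι hι (isMulCocycle₁_toMulFun a))

/-- `Z¹(Γ, T) → H¹(Γ, G)` is constant on cohomology classes. [cite: Berhuy2010, §II.3 Prop. II.3.19] -/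
theorem cocyclesToNonAbelianH1_eq_of_H1π_eq {a a' : cocycles₁ (Rep.ofMulDistribMulAction Γ T)}
    (h : H1π _ a = H1π _ a') : cocyclesToNonAbelianH1 ι hι a = cocyclesToNonAbelianH1 ι hι a' := by
  rw [cocyclesToNonAbelianH1, cocyclesToNonAbelianH1, NonAbelianH1.mk_eq_mk_iff]
  exact cohomologous_comp ι hι (cohomologous_of_H1π_eq h)

/-- **The map of pointed sets `H¹(Γ, T) → H¹(Γ, G)` induced by `ι`.** [cite: Berhuy2010, §II.3 Prop. II.3.19] -/
noncomputable def H1toNonAbelian (x : H1 (Rep.ofMulDistribMulAction Γ T)) : NonAbelianH1 Γ G :=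
  cocyclesToNonAbelianH1 ι hι (Classical.choose (H1π_surjective (Γ := Γ) (T := T) x))

/-- `H1toNonAbelian [a] = [ι ∘ a]`. [cite: Berhuy2010, §II.3 Prop. II.3.19] -/
theorem H1toNonAbelian_H1π (a : cocycles₁ (Rep.ofMulDistribMulAction Γ T)) :
    H1toNonAbelian ι hι (H1π _ a) = cocyclesToNonAbelianH1 ι hι a :=
  cocyclesToNonAbelianH1_eq_of_H1π_eq ι hι (Classical.choose_spec (H1π_surjective (Γ := Γ) (T := T) (H1π _ a)))

/-- `H1toNonAbelian` maps `0` to the base point. [cite: Berhuy2010, §II.3 Prop. II.3.19] -/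
theorem H1toNonAbelian_zero : H1toNonAbelian ι hι 0 = NonAbelianH1.base Γ G := by
  have h0 : H1π (Rep.ofMulDistribMulAction Γ T) 0 = 0 := map_zero _
  rw [← h0, H1toNonAbelian_H1π, cocyclesToNonAbelianH1, NonAbelianH1.mk_eq_base_iff]
  refine ⟨1, funext fun σ => ?_⟩
  rw [splitCocycle_apply, smul_one, inv_one, mul_one, Function.comp_apply, toMulFun_apply]
  change ι (Additive.toMul 0) = 1
  rw [toMul_zero, map_one]

/-- **`𝔇 = ker (H¹(Γ, T) → H¹(Γ, G))`** — the preimage of the base point [Berhuy2010, Def. II.4.1]; for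
`T ⊂ G` the `F̄`-points of a maximal torus (or of the abelian centraliser `G_γ`) of a reductive group with the
Galois action this is Rogawski's `𝔇(T/F) = 𝔇_G(T/F) = Ker{H¹(F, T) → H¹(F, G)}`, which parametrises the
conjugacy classes within a stable conjugacy class. [cite: Rogawski1990, §3.1 p. 19] -/
def kerH1 : Set (H1 (Rep.ofMulDistribMulAction Γ T)) :=
  H1toNonAbelian ι hι ⁻¹' {NonAbelianH1.base Γ G}

/-- Membership in `𝔇` is literally «maps to the base point». [cite: Berhuy2010, §II.4 Def. II.4.1] -/
theorem mem_kerH1_iff (x : H1 (Rep.ofMulDistribMulAction Γ T)) :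
    x ∈ kerH1 ι hι ↔ H1toNonAbelian ι hι x = NonAbelianH1.base Γ G := Iff.rfl

/-- **Concrete description of `𝔇`**: the class of a cocycle `a : Γ → T` lies in `𝔇` iff
`ι ∘ a` splits in `G`: `∃ g ∈ G, ∀ σ, ι (a σ) = g (σ • g)⁻¹` (Rogawski: the classes of the cocycles `{τ(g)g⁻¹}`,
`g ∈ G(F̄)`, with values in `T`). [cite: Rogawski1990, §3.1 p. 19] -/
theorem H1π_mem_kerH1_iff (a : cocycles₁ (Rep.ofMulDistribMulAction Γ T)) :
    H1π _ a ∈ kerH1 ι hι ↔ ∃ g : G, ∀ σ, ι (toMulFun a σ) = g * (σ • g)⁻¹ := by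
  rw [mem_kerH1_iff, H1toNonAbelian_H1π, cocyclesToNonAbelianH1, NonAbelianH1.mk_eq_base_iff]
  simp only [funext_iff, Function.comp_apply, splitCocycle_apply]

/-- `0 ∈ 𝔇`. [cite: Berhuy2010, §II.4 Def. II.4.1] -/
theorem zero_mem_kerH1 : (0 : H1 (Rep.ofMulDistribMulAction Γ T)) ∈ kerH1 ι hι :=
  H1toNonAbelian_zero ι hι

end Kernel

end Literature.NumberTheory.GaloisCohomology
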